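import Summits.QuantumFields.YangMills.Theorems.BalabanUVNodesK3V5Defs
import Summits.QuantumFields.YangMills.Theorems.BalabanUVNodesN14ClassLawRoadsZeroDialAtSpineReadingOfRecord13CoPHV

/-!
# BalabanUVNodes ∕ N14 — K3⁷ v5 STUB 2's REGISTERED TEXT, BY NAME (`K3V5Defs`), AT CUT 0 WITH n21-d's SHELL SPLIT OF RECORD ⇐ the KEYED live-selector line + (H-ζ) + node N21's
# `KeyedShellWeight` AT THAT SPLIT (hypothesis BY NAME) + ONE KEYED t-free class-law sentence of node U3 on the SHELL-FREE class laws GIVEN THE RATES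

Cell `pub-ymgap` (HUMAN RULING D-0062 Track A; director-ym №197 ∕ HUMAN RULING D-0149), WIDTH SEAT `pub-ymgap-dag-n14-w2` (g5), CLAIM-2 ∕ INTENT-2 (bus 2026-08-28T06:18Z; in-lane
successor of this seat's p608685 `…N14ClassLawRoadsStubTwoTextK3V5` — the ZERO-DIAL edition — along the shell-split-of-record road of g2 p594686 ∕ p596111 and g3 p599679 §2–§3).
Filed `--kind proof --supports stmt-QuantumFields-20544 --as helper` (K3⁷ `SpineGivenEndpointR13SepCoPH`; skeleton OF RECORD v5 941dddb108cbaacf, plan g82 l.28563 ∕ g83: v5 STANDS).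
COUNT-NEUTRAL.  THEOREMS ONLY (0 `def`).  Imports dag-n27-w1's BY-NAME MIRROR `…K3V5Defs` (p606160) and this seat's g3 FILE 2 `…N14ClassLawRoadsZeroDialAtSpineReadingOfRecord13CoPHV`
(p601321; through it FILE 1 p599679 `core_crOfRecord₁₃VAt_shellSplitOfRecord_of_classSandwich ∕ _of_massSandwich_of_tv`, g2's shell sibling p594686 `shellMeasA₁₃ ∕ B₁₃`, dag-n21-d's
`shellSplitOfRecord₁₃At` ∕ `WidthLetter₁₃CoPH`, dag-n20-w1's `…N20ZeroDialFacesAtRecord13CoPHV` shapes, dag-n20-w2's `zeta_nonneg_of_provisos₁₃CoPH`, dag-n20-d's `crOfRecord₁₃V ∕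
crOfRecord₁₃VAt` p590105, node00-def-K0c's absolute (H-U) `Node00.localBgMeasurable`) — all BY NAME; edits nothing; does NOT import p608685 (not needed).

WHY A SECOND EDITION (located, said against this seat's own p608685).  `stub_expansion13H` leaves BOTH dials to the prover: the cut reading `jc` and the shell split `sh`.  p608685 took
the ZERO DIAL `(jc, sh) = (0, 0)`: there node U3's sentence is asked on the FULL class laws of record — a one-constant per-class matching of the two runs on EVERY keyed class, the
LARGE-FIELD classes included, which print BOUNDS (the R-operation ∕ (1.80) of [LF-II], the relative weights of [III] §3) rather than MATCHES.  dag-n20-w1's located (i) (p606432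
`stubTwoBody_iff_zeroCut`): the CUT folds into the shell split budget-free — so cut 0 loses nothing PROVIDED the shell split stays free; the shell does not fold away.  THIS FILE is the
cut-0 edition WITH n21-d's shell split of record `shellSplitOfRecord₁₃At 2 0 ρA ρB` (free width letters `ρA ρB`): node U3's sentence is asked only on the SHELL-FREE parts
`classMeasA₁₃ − shellMeasA₁₃ (ρA …)` ∕ `classMeasB₁₃ − shellMeasB₁₃ (ρB …)`, the shells carrying what node N21 bounds — the print-faithful division of labour:
N20 FREE at cut 0 · N21 = `KeyedShellWeight` at the split of record (a HYPOTHESIS here, BY NAME; suppliers: dag-n21-w2's dilation ∕ chart roads) · N27x = the keyed live line · N19′ = U3's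
sentence on the shell-free laws GIVEN the rates.  Which edition a U3 producer can meet is NODE O's ∕ the n21 lanes' content question; nothing is decided here.
* §1 ★★ `keyedCoreEdgeHolderD4_crOfRecord₁₃VAt_shellSplitOfRecord_of_keyedShellFreeClassSandwich` — for EVERY `β rr K₀ ρA ρB`: `K3V5Defs.KeyedCoreEdgeHolderD4 β (crOfRecord₁₃VAt K₀ 0
  (shellSplitOfRecord₁₃At 2 K₀ ρA ρB)) rr` ⇐ keyed live line + (H-ζ) + ONE keyed sentence under the crux's prefix, GIVEN the rates, on the shell-free class laws (all keys, t-free; FILE 1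
  §2 + `ForSmallCouplings.mono`; `0 ≤ ζ` READ OFF the provisos) · ★★ `…_of_keyedShellFreeMassTV` (MASS_cl ∧ TV_cl twin, dag-n19-c currency; FILE 1 §3).
* §2 ★★★ `stubExpansion13HText_shellSplitOfRecord_of_liveLine_of_keyedShellWeight_of_keyedShellFreeClassSandwich` — the v5 `stub_expansion13H` TEXT VERBATIM in `K3V5Defs` names ⇐ keyed
  live line + N21's keyed face at the split BY NAME + «stub 2's own hypotheses ⇒ U3's keyed shell-free sentence at `(β, rrOfRecord 𝔯 ksel)`»; witness `(0, shellSplitOfRecord₁₃At 2 0 ρA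
  ρB, crOfRecord₁₃V 0 that)` · ★★ `…_of_keyedShellFreeMassTV`.
* §3 `spineGivenEndpointR13SepCoPH_of_stubRatesText_shellSplitOfRecord_of_liveLine_of_keyedShellWeight_of_keyedShellFreeClassSandwich` — K3⁷ BY NAME modulo stub 1's TEXT, ONE application of
  `K3V5Defs.spineGivenEndpointR13SepCoPH_of_stubTexts` (pattern GO'd by dag-n27-c g13 for p608685 §5).

HONEST FRAMING.  By-name bookkeeping over HYPOTHESIS SHAPES; ZERO ESTIMATE CONTENT.  The keyed live line, node N21's keyed shell-weight face at the split of record and node U3's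
keyed sentence are DISPLAYED hypotheses inhabited for NO tuple (K0⁷ `Record13SepCoPHInhabited` OPEN) and produced by nobody; nothing of Bałaban's is asserted; NE7 ∕ NE7b ∕ NE7c ∕
NE1′ NOT PRINTED for d = 4, NOT proved; N14 ∕ N19 ∕ N20 ∕ N21 ∕ N27 NOT discharged; NOT a proof of `stub_expansion13H` (its text is concluded UNDER three displayed hypotheses) and §3
is NOT a proof of K3⁷ (stub 1's text is a hypothesis too); K3⁷ OPEN, NOT claimed; counts UNMOVED (typed 28∕28 · discharged 5∕28); one finite four-torus programme at fixed `ε = L^{−K}`,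
Bałaban AS PRINTED — the YM mass gap (Clay) is NOT proved by any of this: R4 closes only the conditional finite-𝕋⁴ rung `BalabanLadder.UV`; NOT ℝ⁴, NOT OS, NOT a mass gap, NOT Clay.
0 `def`, 0 `instance`, 0 `sorry`, standard axioms; no decl below carries a cite tag.
-/

set_option autoImplicit false

noncomputable section

open MeasureTheory ProbabilityTheory Finset
open scoped ENNReal BigOperators Matrix.Norms.L2Operator

namespace YMDAG.N14.AtSpineReading13CoPH.V.ClassLawRoads.K3V5Shell

open Literature.MathematicalPhysics.QuantumFieldTheory.Balaban1983to89
open Literature.MathematicalPhysics.QuantumFieldTheory.Balaban1983to89.T4Continuum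
open Literature.MathematicalPhysics.QuantumFieldTheory.Balaban1983to89.Node00
open T4ContinuumYM4Torus (ForSmallCouplings)
open Summit.QuantumFields.BalabanUV.T4Continuum.Spine
open Summit.QuantumFields.YangMills.Theorems.K3V5Defs (SpineReading RateReadingFn RunSel LetterReading CutReading rrOfRecord PHolderD4 KeyedRatesHolderD4 GuardedReadingN16
  KeyedRelWeight KeyedShellWeight KeyedCoreEdgeHolderD4 KeyedExtraction LiveSel PinnedAtLive spineGivenEndpointR13SepCoPH_of_stubTexts)
open Summit.QuantumFields.YangMills.Theorems.N21ShellSplitOfRecord13CoPH (shellSplitOfRecord₁₃At WidthLetter₁₃CoPH)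
open Summit.QuantumFields.YangMills.BalabanUVNodes.N20ZeroDialFacesAtRecord13CoPHV (keyedRelWeight_shape_crOfRecord₁₃V_cutZero keyedExtraction_shape_crOfRecord₁₃VAt_cutReading_of_live)
open Summit.QuantumFields.YangMills.BalabanUVNodes.N21KeyedShellWeightShellZero (zeta_nonneg_of_provisos₁₃CoPH)
open YMDAG.UVSplit hiding SU
open YMDAG.N14.AtSpineReading13CoPH
open YMDAG.N14.AtSpineReading13CoPH.Shell
open YMDAG.N14.AtSpineReading13CoPH.V.ClassLawRoads (core_crOfRecord₁₃VAt_shellSplitOfRecord_of_classSandwich core_crOfRecord₁₃VAt_shellSplitOfRecord_of_massSandwich_of_tv)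

/-! ## §1 ★★ The N19′ conjunct BY NAME at cut 0 with the shell split of record, from ONE keyed sentence on the SHELL-FREE class laws given the rates -/

section CoreEdge

variable (β : ℝ) (rr : RateReadingFn) (K₀ : ℕ) (ρA ρB : WidthLetter₁₃CoPH 2)
  (hlive : ∀ (F : T4Family) (θ : Stage13HParams F 2), θ.Provisos₁₃CoPH F 2 → (θ.ZhUnity F 2 ∧ θ.SlotsNondegenerate₁₃ F 2) → θ.Admissible F 2 →
    LiveSel F θ ∧ ZetaMeasurable F 2 θ.ζ)
include hlive

/-- **★★ `KeyedCoreEdgeHolderD4` AT CUT 0 WITH THE SHELL SPLIT OF RECORD ⇐ NODE U3's KEYED CLASS-MEASURE SENTENCE ON THE SHELL-FREE LAWS, GIVEN THE RATES.**  For EVERY exponent `β`, rate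
reading `rr`, prefix `K₀` and width letters `ρA ρB`: IF (keyed live line + (H-ζ)) and IF at every guarded admissible tuple, under the crux's prefix `(B) → END → ForSmallCouplings D`, for every
`os`, GIVEN `PHolderD4 β D (rr F θ hP g₀ os)`: SOME summable `r` and for every `K` ONE `c` with `e^{c − r K}•(classMeasA₁₃ K x − shellMeasA₁₃ (ρA …) K x).map A_{K₀+K} ≤ (classMeasB₁₃ K x −
shellMeasB₁₃ (ρB …) K x).map A_{K₀+K+1} ≤ e^{c + r K}•…` AS MEASURES on the unit lattice for EVERY key `x ∈ classSet₁₃ K` (t-free; a bad class only removes obligations, and at cut 0 there is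
none) — THEN `K3V5Defs.KeyedCoreEdgeHolderD4 β (crOfRecord₁₃VAt K₀ (fun _ ↦ 0) (shellSplitOfRecord₁₃At 2 K₀ ρA ρB)) rr` (FILE 1 `core_crOfRecord₁₃VAt_shellSplitOfRecord_of_classSandwich`, the
MGF-part form of the split DISCHARGED by g2's shell sibling, `0 ≤ ζ` by dag-n20-w2's `zeta_nonneg_of_provisos₁₃CoPH`, `ForSmallCouplings.mono`).  NE7-S_cl on the SHELL-FREE laws GIVEN THE
RATES; NOT PRINTED for d = 4; produced by nobody. [bookkeeping] -/
theorem keyedCoreEdgeHolderD4_crOfRecord₁₃VAt_shellSplitOfRecord_of_keyedShellFreeClassSandwich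
    (hS : ∀ (F : T4Family) (θ : Stage13HParams F 2) (hP : θ.Provisos₁₃CoPH F 2), (θ.ZhUnity F 2 ∧ θ.SlotsNondegenerate₁₃ F 2) → θ.Admissible F 2 →
      B16.EndStatementBPrinted (datumOfRecord₁₃CoPH F 2 θ hP).C → DagBinding.EndpointExistence (datumOfRecord₁₃CoPH F 2 θ hP).C.toB12 →
        ForSmallCouplings (datumOfRecord₁₃CoPH F 2 θ hP) fun g₀ => ∀ os : List (ULoop F), PHolderD4 β (datumOfRecord₁₃CoPH F 2 θ hP) (rr F θ hP g₀ os) →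
          ∃ r : ℕ → ℝ, Summable r ∧ ∀ K : ℕ, ∃ c : ℝ, ∀ x ∈ classSet₁₃ θ K₀ g₀ K,
            ENNReal.ofReal (Real.exp (c - r K)) • (classMeasA₁₃ θ K₀ g₀ K x - shellMeasA₁₃ θ K₀ g₀ (ρA F θ hP g₀ os) K x).map ((T4RunLadder.unitFactorisation (datumOfRecord₁₃CoPH F 2 θ hP) (isPrintedAveraged_datumOfRecord₁₃CoPH F 2 θ hP).avgMeasurable g₀).A (K₀ + K)) ≤ (classMeasB₁₃ θ K₀ g₀ K x - shellMeasB₁₃ θ K₀ g₀ (ρB F θ hP g₀ os) K x).map ((T4RunLadder.unitFactorisation (datumOfRecord₁₃CoPH F 2 θ hP) (isPrintedAveraged_datumOfRecord₁₃CoPH F 2 θ hP).avgMeasurable g₀).A (K₀ + K + 1)) ∧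
            (classMeasB₁₃ θ K₀ g₀ K x - shellMeasB₁₃ θ K₀ g₀ (ρB F θ hP g₀ os) K x).map ((T4RunLadder.unitFactorisation (datumOfRecord₁₃CoPH F 2 θ hP) (isPrintedAveraged_datumOfRecord₁₃CoPH F 2 θ hP).avgMeasurable g₀).A (K₀ + K + 1)) ≤ ENNReal.ofReal (Real.exp (c + r K)) • (classMeasA₁₃ θ K₀ g₀ K x - shellMeasA₁₃ θ K₀ g₀ (ρA F θ hP g₀ os) K x).map ((T4RunLadder.unitFactorisation (datumOfRecord₁₃CoPH F 2 θ hP) (isPrintedAveraged_datumOfRecord₁₃CoPH F 2 θ hP).avgMeasurable g₀).A (K₀ + K))) :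
    KeyedCoreEdgeHolderD4 β (crOfRecord₁₃VAt K₀ (fun _ => 0) (shellSplitOfRecord₁₃At 2 K₀ ρA ρB)) rr := by
  intro F θ hP hG hθ hB hE
  letI : DecidableEq (Σ K, SiteSeqKey F (K₀ + K)) := Classical.decEq _
  obtain ⟨hsel, hζm⟩ := hlive F θ hP hG hθ
  refine (hS F θ hP hG hθ hB hE).mono fun g₀ h => ?_
  intro os hrates
  obtain ⟨r, hrs, hc⟩ := h os hrates
  refine ⟨_, core_crOfRecord₁₃VAt_shellSplitOfRecord_of_classSandwich θ hP K₀ (fun _ => 0) ρA ρB _ hsel hζm (zeta_nonneg_of_provisos₁₃CoPH F θ hP) g₀ os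
    (fun K => ?_) hrs⟩
  obtain ⟨c, hcK⟩ := hc K
  exact ⟨c, fun t _ x hx => hcK x (Finset.mem_sdiff.1 hx).1⟩

/-- **★★ THE SAME FROM NODE U3's KEYED MASS ∧ TV PAIR ON THE SHELL-FREE LAWS, GIVEN THE RATES** (dag-n19-c currency: MASS_cl(`r₁`) of the shell-free class measures of record THEMSELVES
∧ TV_cl(`ρ`) of their NORMALISED push-forwards on every measurable set of the unit lattice, every key, `Σ r₁, Σ ρ < ∞`; FILE 1 `core_crOfRecord₁₃VAt_shellSplitOfRecord_of_massSandwich_of_tv`;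
no (I)-binder, no mean-value step).  NOT PRINTED for d = 4; produced by nobody. [bookkeeping] -/
theorem keyedCoreEdgeHolderD4_crOfRecord₁₃VAt_shellSplitOfRecord_of_keyedShellFreeMassTV
    (hMT : ∀ (F : T4Family) (θ : Stage13HParams F 2) (hP : θ.Provisos₁₃CoPH F 2), (θ.ZhUnity F 2 ∧ θ.SlotsNondegenerate₁₃ F 2) → θ.Admissible F 2 →
      B16.EndStatementBPrinted (datumOfRecord₁₃CoPH F 2 θ hP).C → DagBinding.EndpointExistence (datumOfRecord₁₃CoPH F 2 θ hP).C.toB12 →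
        ForSmallCouplings (datumOfRecord₁₃CoPH F 2 θ hP) fun g₀ => ∀ os : List (ULoop F), PHolderD4 β (datumOfRecord₁₃CoPH F 2 θ hP) (rr F θ hP g₀ os) →
          ∃ r₁ ρ : ℕ → ℝ, Summable r₁ ∧ Summable ρ ∧
            (∀ K : ℕ, ∃ c : ℝ, ∀ x ∈ classSet₁₃ θ K₀ g₀ K,
              ENNReal.ofReal (Real.exp (c - r₁ K)) * (classMeasA₁₃ θ K₀ g₀ K x - shellMeasA₁₃ θ K₀ g₀ (ρA F θ hP g₀ os) K x) Set.univ ≤ (classMeasB₁₃ θ K₀ g₀ K x - shellMeasB₁₃ θ K₀ g₀ (ρB F θ hP g₀ os) K x) Set.univ ∧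
                (classMeasB₁₃ θ K₀ g₀ K x - shellMeasB₁₃ θ K₀ g₀ (ρB F θ hP g₀ os) K x) Set.univ ≤ ENNReal.ofReal (Real.exp (c + r₁ K)) * (classMeasA₁₃ θ K₀ g₀ K x - shellMeasA₁₃ θ K₀ g₀ (ρA F θ hP g₀ os) K x) Set.univ) ∧
            (∀ (K : ℕ), ∀ x ∈ classSet₁₃ θ K₀ g₀ K, ∀ S : Set (GaugeField (F.P 0) 0 (Node00.SU 2)), MeasurableSet S →
              |((classMeasB₁₃ θ K₀ g₀ K x - shellMeasB₁₃ θ K₀ g₀ (ρB F θ hP g₀ os) K x).map ((T4RunLadder.unitFactorisation (datumOfRecord₁₃CoPH F 2 θ hP) (isPrintedAveraged_datumOfRecord₁₃CoPH F 2 θ hP).avgMeasurable g₀).A (K₀ + K + 1))).real S / ((classMeasB₁₃ θ K₀ g₀ K x - shellMeasB₁₃ θ K₀ g₀ (ρB F θ hP g₀ os) K x).map ((T4RunLadder.unitFactorisation (datumOfRecord₁₃CoPH F 2 θ hP) (isPrintedAveraged_datumOfRecord₁₃CoPH F 2 θ hP).avgMeasurable g₀).A (K₀ + K + 1))).real Set.univ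 -
                ((classMeasA₁₃ θ K₀ g₀ K x - shellMeasA₁₃ θ K₀ g₀ (ρA F θ hP g₀ os) K x).map ((T4RunLadder.unitFactorisation (datumOfRecord₁₃CoPH F 2 θ hP) (isPrintedAveraged_datumOfRecord₁₃CoPH F 2 θ hP).avgMeasurable g₀).A (K₀ + K))).real S / ((classMeasA₁₃ θ K₀ g₀ K x - shellMeasA₁₃ θ K₀ g₀ (ρA F θ hP g₀ os) K x).map ((T4RunLadder.unitFactorisation (datumOfRecord₁₃CoPH F 2 θ hP) (isPrintedAveraged_datumOfRecord₁₃CoPH F 2 θ hP).avgMeasurable g₀).A (K₀ + K))).real Set.univ| ≤ ρ K)) :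
    KeyedCoreEdgeHolderD4 β (crOfRecord₁₃VAt K₀ (fun _ => 0) (shellSplitOfRecord₁₃At 2 K₀ ρA ρB)) rr := by
  intro F θ hP hG hθ hB hE
  letI : DecidableEq (Σ K, SiteSeqKey F (K₀ + K)) := Classical.decEq _
  obtain ⟨hsel, hζm⟩ := hlive F θ hP hG hθ
  refine (hMT F θ hP hG hθ hB hE).mono fun g₀ h => ?_
  intro os hrates
  obtain ⟨r₁, ρ, hr₁, hρ, hM, hTV⟩ := h os hrates
  refine ⟨_, core_crOfRecord₁₃VAt_shellSplitOfRecord_of_massSandwich_of_tv θ hP K₀ (fun _ => 0) ρA ρB _ hsel hζm (zeta_nonneg_of_provisos₁₃CoPH F θ hP) g₀ os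
    (fun K => ?_) (fun K t _ x hx S hSm => hTV K x (Finset.mem_sdiff.1 hx).1 S hSm) hr₁ hρ⟩
  obtain ⟨c, hcK⟩ := hM K
  exact ⟨c, fun t _ x hx => hcK x (Finset.mem_sdiff.1 hx).1⟩

end CoreEdge

/-! ## §2 ★★★ STUB 2's REGISTERED TEXT at cut 0 with the shell split of record, from the three keyed hypotheses -/

section StubText

variable (ρA ρB : WidthLetter₁₃CoPH 2)
  (hlive : ∀ (F : T4Family) (θ : Stage13HParams F 2), θ.Provisos₁₃CoPH F 2 → (θ.ZhUnity F 2 ∧ θ.SlotsNondegenerate₁₃ F 2) → θ.Admissible F 2 →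
    LiveSel F θ ∧ ZetaMeasurable F 2 θ.ζ)
  (hN21 : KeyedShellWeight (crOfRecord₁₃V (fun _ => 0) (shellSplitOfRecord₁₃At 2 0 ρA ρB)))
include hlive hN21

/-- **★★★ K3⁷ v5 STUB 2's TEXT, VERBATIM, AT CUT 0 WITH THE SHELL SPLIT OF RECORD.**  IF (keyed live-selector line + (H-ζ)), IF node N21's keyed shell-weight face holds at the V record reading
with cut 0 and n21-d's shell split of record `shellSplitOfRecord₁₃At 2 0 ρA ρB` (`K3V5Defs.KeyedShellWeight …`, a HYPOTHESIS BY NAME — suppliers: dag-n21-w2's dilation ∕ chart roads), and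
IF stub 2's own two hypotheses yield node U3's keyed one-constant class-measure sentence ON THE SHELL-FREE LAWS at `(β, rrOfRecord 𝔯 ksel)`, `K₀ = 0` (§1's shape, GIVEN the rates),
THEN the registered conclusion holds with the witness `(jc, sh, cr) := (0, shellSplitOfRecord₁₃At 2 0 ρA ρB, crOfRecord₁₃V 0 that)`: `PinnedAtLive` (`rfl`), `KeyedRelWeight` (FREE at cut 0,
dag-n20-w1's shape BY NAME), `KeyedShellWeight` (the N21 hypothesis), `KeyedExtraction` (the live line, dag-n20-w1's shape + node00-def-K0c's `localBgMeasurable`), `KeyedCoreEdgeHolderD4`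
(§1).  NOT a proof of `stub_expansion13H`: three DISPLAYED hypotheses, inhabited ∕ produced by nobody (K0⁷ OPEN). [bookkeeping] -/
theorem stubExpansion13HText_shellSplitOfRecord_of_liveLine_of_keyedShellWeight_of_keyedShellFreeClassSandwich
    (hU3 : ∀ β : ℝ, 2 / 3 < β → β < 1 →
      ∀ (𝔯 : RateReading₁₃CoPH 2) (ksel : RunSel) (ℓ : LetterReading) (ℓ₃ : T4Family → Node00.NE3Letters₁₁) (g B : T4Family → ℝ),
        GuardedReadingN16 𝔯 ksel ℓ ℓ₃ g B → KeyedRatesHolderD4 β (rrOfRecord 𝔯 ksel) →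
        ∀ (F : T4Family) (θ : Stage13HParams F 2) (hP : θ.Provisos₁₃CoPH F 2), (θ.ZhUnity F 2 ∧ θ.SlotsNondegenerate₁₃ F 2) → θ.Admissible F 2 →
          B16.EndStatementBPrinted (datumOfRecord₁₃CoPH F 2 θ hP).C → DagBinding.EndpointExistence (datumOfRecord₁₃CoPH F 2 θ hP).C.toB12 →
            ForSmallCouplings (datumOfRecord₁₃CoPH F 2 θ hP) fun g₀ => ∀ os : List (ULoop F),
              PHolderD4 β (datumOfRecord₁₃CoPH F 2 θ hP) (rrOfRecord 𝔯 ksel F θ hP g₀ os) →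
                ∃ r : ℕ → ℝ, Summable r ∧ ∀ K : ℕ, ∃ c : ℝ, ∀ x ∈ classSet₁₃ θ 0 g₀ K,
                  ENNReal.ofReal (Real.exp (c - r K)) • (classMeasA₁₃ θ 0 g₀ K x - shellMeasA₁₃ θ 0 g₀ (ρA F θ hP g₀ os) K x).map ((T4RunLadder.unitFactorisation (datumOfRecord₁₃CoPH F 2 θ hP) (isPrintedAveraged_datumOfRecord₁₃CoPH F 2 θ hP).avgMeasurable g₀).A (0 + K)) ≤ (classMeasB₁₃ θ 0 g₀ K x - shellMeasB₁₃ θ 0 g₀ (ρB F θ hP g₀ os) K x).map ((T4RunLadder.unitFactorisation (datumOfRecord₁₃CoPH F 2 θ hP) (isPrintedAveraged_datumOfRecord₁₃CoPH F 2 θ hP).avgMeasurable g₀).A (0 + K + 1)) ∧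
                  (classMeasB₁₃ θ 0 g₀ K x - shellMeasB₁₃ θ 0 g₀ (ρB F θ hP g₀ os) K x).map ((T4RunLadder.unitFactorisation (datumOfRecord₁₃CoPH F 2 θ hP) (isPrintedAveraged_datumOfRecord₁₃CoPH F 2 θ hP).avgMeasurable g₀).A (0 + K + 1)) ≤ ENNReal.ofReal (Real.exp (c + r K)) • (classMeasA₁₃ θ 0 g₀ K x - shellMeasA₁₃ θ 0 g₀ (ρA F θ hP g₀ os) K x).map ((T4RunLadder.unitFactorisation (datumOfRecord₁₃CoPH F 2 θ hP) (isPrintedAveraged_datumOfRecord₁₃CoPH F 2 θ hP).avgMeasurable g₀).A (0 + K))) :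
    ∀ β : ℝ, 2 / 3 < β → β < 1 →
      ∀ (𝔯 : RateReading₁₃CoPH 2) (ksel : RunSel) (ℓ : LetterReading) (ℓ₃ : T4Family → Node00.NE3Letters₁₁) (g B : T4Family → ℝ),
        GuardedReadingN16 𝔯 ksel ℓ ℓ₃ g B → KeyedRatesHolderD4 β (rrOfRecord 𝔯 ksel) →
        ∃ (jc : CutReading) (sh : ShellSplit₁₃CoPH 2 0) (cr : SpineReading), PinnedAtLive jc sh cr ∧
          KeyedRelWeight cr ∧ KeyedShellWeight cr ∧ KeyedExtraction cr ∧ KeyedCoreEdgeHolderD4 β cr (rrOfRecord 𝔯 ksel) := by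
  intro β hβ hβ' 𝔯 ksel ℓ ℓ₃ g B hG hr
  exact ⟨fun _ _ _ _ _ _ => 0, shellSplitOfRecord₁₃At 2 0 ρA ρB, crOfRecord₁₃V (fun _ => 0) (shellSplitOfRecord₁₃At 2 0 ρA ρB),
    fun _ _ _ _ _ _ => rfl, keyedRelWeight_shape_crOfRecord₁₃V_cutZero _, hN21,
    keyedExtraction_shape_crOfRecord₁₃VAt_cutReading_of_live (fun _ _ _ _ _ => fun _ => 0) (shellSplitOfRecord₁₃At 2 0 ρA ρB) fun F θ hP hG' hθ' =>
      ⟨(hlive F θ hP hG' hθ').1, localBgMeasurable F 2 θ.ν, (hlive F θ hP hG' hθ').2⟩,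
    keyedCoreEdgeHolderD4_crOfRecord₁₃VAt_shellSplitOfRecord_of_keyedShellFreeClassSandwich β (rrOfRecord 𝔯 ksel) 0 ρA ρB hlive (hU3 β hβ hβ' 𝔯 ksel ℓ ℓ₃ g B hG hr)⟩

/-- **★★ … AND FROM NODE U3's KEYED MASS ∧ TV PAIR ON THE SHELL-FREE LAWS, GIVEN THE RATES** (§1 twin, dag-n19-c currency). [bookkeeping] -/
theorem stubExpansion13HText_shellSplitOfRecord_of_liveLine_of_keyedShellWeight_of_keyedShellFreeMassTV
    (hU3 : ∀ β : ℝ, 2 / 3 < β → β < 1 →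
      ∀ (𝔯 : RateReading₁₃CoPH 2) (ksel : RunSel) (ℓ : LetterReading) (ℓ₃ : T4Family → Node00.NE3Letters₁₁) (g B : T4Family → ℝ),
        GuardedReadingN16 𝔯 ksel ℓ ℓ₃ g B → KeyedRatesHolderD4 β (rrOfRecord 𝔯 ksel) →
        ∀ (F : T4Family) (θ : Stage13HParams F 2) (hP : θ.Provisos₁₃CoPH F 2), (θ.ZhUnity F 2 ∧ θ.SlotsNondegenerate₁₃ F 2) → θ.Admissible F 2 →
          B16.EndStatementBPrinted (datumOfRecord₁₃CoPH F 2 θ hP).C → DagBinding.EndpointExistence (datumOfRecord₁₃CoPH F 2 θ hP).C.toB12 →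
            ForSmallCouplings (datumOfRecord₁₃CoPH F 2 θ hP) fun g₀ => ∀ os : List (ULoop F),
              PHolderD4 β (datumOfRecord₁₃CoPH F 2 θ hP) (rrOfRecord 𝔯 ksel F θ hP g₀ os) →
                ∃ r₁ ρ : ℕ → ℝ, Summable r₁ ∧ Summable ρ ∧
                  (∀ K : ℕ, ∃ c : ℝ, ∀ x ∈ classSet₁₃ θ 0 g₀ K,
                    ENNReal.ofReal (Real.exp (c - r₁ K)) * (classMeasA₁₃ θ 0 g₀ K x - shellMeasA₁₃ θ 0 g₀ (ρA F θ hP g₀ os) K x) Set.univ ≤ (classMeasB₁₃ θ 0 g₀ K x - shellMeasB₁₃ θ 0 g₀ (ρB F θ hP g₀ os) K x) Set.univ ∧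
                      (classMeasB₁₃ θ 0 g₀ K x - shellMeasB₁₃ θ 0 g₀ (ρB F θ hP g₀ os) K x) Set.univ ≤ ENNReal.ofReal (Real.exp (c + r₁ K)) * (classMeasA₁₃ θ 0 g₀ K x - shellMeasA₁₃ θ 0 g₀ (ρA F θ hP g₀ os) K x) Set.univ) ∧
                  (∀ (K : ℕ), ∀ x ∈ classSet₁₃ θ 0 g₀ K, ∀ S : Set (GaugeField (F.P 0) 0 (Node00.SU 2)), MeasurableSet S →
                    |((classMeasB₁₃ θ 0 g₀ K x - shellMeasB₁₃ θ 0 g₀ (ρB F θ hP g₀ os) K x).map ((T4RunLadder.unitFactorisation (datumOfRecord₁₃CoPH F 2 θ hP) (isPrintedAveraged_datumOfRecord₁₃CoPH F 2 θ hP).avgMeasurable g₀).A (0 + K + 1))).real S / ((classMeasB₁₃ θ 0 g₀ K x - shellMeasB₁₃ θ 0 g₀ (ρB F θ hP g₀ os) K x).map ((T4RunLadder.unitFactorisation (datumOfRecord₁₃CoPH F 2 θ hP) (isPrintedAveraged_datumOfRecord₁₃CoPH F 2 θ hP).avgMeasurable g₀).A (0 + K + 1))).real Set.univ -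
                      ((classMeasA₁₃ θ 0 g₀ K x - shellMeasA₁₃ θ 0 g₀ (ρA F θ hP g₀ os) K x).map ((T4RunLadder.unitFactorisation (datumOfRecord₁₃CoPH F 2 θ hP) (isPrintedAveraged_datumOfRecord₁₃CoPH F 2 θ hP).avgMeasurable g₀).A (0 + K))).real S / ((classMeasA₁₃ θ 0 g₀ K x - shellMeasA₁₃ θ 0 g₀ (ρA F θ hP g₀ os) K x).map ((T4RunLadder.unitFactorisation (datumOfRecord₁₃CoPH F 2 θ hP) (isPrintedAveraged_datumOfRecord₁₃CoPH F 2 θ hP).avgMeasurable g₀).A (0 + K))).real Set.univ| ≤ ρ K)) :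
    ∀ β : ℝ, 2 / 3 < β → β < 1 →
      ∀ (𝔯 : RateReading₁₃CoPH 2) (ksel : RunSel) (ℓ : LetterReading) (ℓ₃ : T4Family → Node00.NE3Letters₁₁) (g B : T4Family → ℝ),
        GuardedReadingN16 𝔯 ksel ℓ ℓ₃ g B → KeyedRatesHolderD4 β (rrOfRecord 𝔯 ksel) →
        ∃ (jc : CutReading) (sh : ShellSplit₁₃CoPH 2 0) (cr : SpineReading), PinnedAtLive jc sh cr ∧
          KeyedRelWeight cr ∧ KeyedShellWeight cr ∧ KeyedExtraction cr ∧ KeyedCoreEdgeHolderD4 β cr (rrOfRecord 𝔯 ksel) := by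
  intro β hβ hβ' 𝔯 ksel ℓ ℓ₃ g B hG hr
  exact ⟨fun _ _ _ _ _ _ => 0, shellSplitOfRecord₁₃At 2 0 ρA ρB, crOfRecord₁₃V (fun _ => 0) (shellSplitOfRecord₁₃At 2 0 ρA ρB),
    fun _ _ _ _ _ _ => rfl, keyedRelWeight_shape_crOfRecord₁₃V_cutZero _, hN21,
    keyedExtraction_shape_crOfRecord₁₃VAt_cutReading_of_live (fun _ _ _ _ _ => fun _ => 0) (shellSplitOfRecord₁₃At 2 0 ρA ρB) fun F θ hP hG' hθ' =>
      ⟨(hlive F θ hP hG' hθ').1, localBgMeasurable F 2 θ.ν, (hlive F θ hP hG' hθ').2⟩,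
    keyedCoreEdgeHolderD4_crOfRecord₁₃VAt_shellSplitOfRecord_of_keyedShellFreeMassTV β (rrOfRecord 𝔯 ksel) 0 ρA ρB hlive (hU3 β hβ hβ' 𝔯 ksel ℓ ℓ₃ g B hG hr)⟩

/-! ## §3 K3⁷ BY NAME modulo stub 1's text, on this road -/

/-- **K3⁷ `SpineGivenEndpointR13SepCoPH` BY NAME ⇐ stub 1's TEXT + the keyed live line + node N21's keyed shell-weight face at the split of record + node U3's keyed sentence on the shell-free
laws.**  ONE application of `K3V5Defs.spineGivenEndpointR13SepCoPH_of_stubTexts` to §2.  What remains of K3⁷ on this road, read off the binders: stub 1 (the pinned rates), the live-selector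
proviso + (H-ζ), N21's shell weight at the split of record, node U3's two-run sentence on the shell-free class laws.  NOT a proof of K3⁷ (four displayed hypotheses, inhabited ∕ produced by
nobody); K3⁷ OPEN, NOT claimed. [bookkeeping] -/
theorem spineGivenEndpointR13SepCoPH_of_stubRatesText_shellSplitOfRecord_of_liveLine_of_keyedShellWeight_of_keyedShellFreeClassSandwich
    (h₁ : ∃ β : ℝ, 2 / 3 < β ∧ β < 1 ∧ ∃ (𝔯 : RateReading₁₃CoPH 2) (ksel : RunSel) (ℓ : LetterReading) (ℓ₃ : T4Family → Node00.NE3Letters₁₁) (g B : T4Family → ℝ),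
      GuardedReadingN16 𝔯 ksel ℓ ℓ₃ g B ∧ KeyedRatesHolderD4 β (rrOfRecord 𝔯 ksel))
    (hU3 : ∀ β : ℝ, 2 / 3 < β → β < 1 →
      ∀ (𝔯 : RateReading₁₃CoPH 2) (ksel : RunSel) (ℓ : LetterReading) (ℓ₃ : T4Family → Node00.NE3Letters₁₁) (g B : T4Family → ℝ),
        GuardedReadingN16 𝔯 ksel ℓ ℓ₃ g B → KeyedRatesHolderD4 β (rrOfRecord 𝔯 ksel) →
        ∀ (F : T4Family) (θ : Stage13HParams F 2) (hP : θ.Provisos₁₃CoPH F 2), (θ.ZhUnity F 2 ∧ θ.SlotsNondegenerate₁₃ F 2) → θ.Admissible F 2 →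
          B16.EndStatementBPrinted (datumOfRecord₁₃CoPH F 2 θ hP).C → DagBinding.EndpointExistence (datumOfRecord₁₃CoPH F 2 θ hP).C.toB12 →
            ForSmallCouplings (datumOfRecord₁₃CoPH F 2 θ hP) fun g₀ => ∀ os : List (ULoop F),
              PHolderD4 β (datumOfRecord₁₃CoPH F 2 θ hP) (rrOfRecord 𝔯 ksel F θ hP g₀ os) →
                ∃ r : ℕ → ℝ, Summable r ∧ ∀ K : ℕ, ∃ c : ℝ, ∀ x ∈ classSet₁₃ θ 0 g₀ K,
                  ENNReal.ofReal (Real.exp (c - r K)) • (classMeasA₁₃ θ 0 g₀ K x - shellMeasA₁₃ θ 0 g₀ (ρA F θ hP g₀ os) K x).map ((T4RunLadder.unitFactorisation (datumOfRecord₁₃CoPH F 2 θ hP) (isPrintedAveraged_datumOfRecord₁₃CoPH F 2 θ hP).avgMeasurable g₀).A (0 + K)) ≤ (classMeasB₁₃ θ 0 g₀ K x - shellMeasB₁₃ θ 0 g₀ (ρB F θ hP g₀ os) K x).map ((T4RunLadder.unitFactorisation (datumOfRecord₁₃CoPH F 2 θ hP) (isPrintedAveraged_datumOfRecord₁₃CoPH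 F 2 θ hP).avgMeasurable g₀).A (0 + K + 1)) ∧
                  (classMeasB₁₃ θ 0 g₀ K x - shellMeasB₁₃ θ 0 g₀ (ρB F θ hP g₀ os) K x).map ((T4RunLadder.unitFactorisation (datumOfRecord₁₃CoPH F 2 θ hP) (isPrintedAveraged_datumOfRecord₁₃CoPH F 2 θ hP).avgMeasurable g₀).A (0 + K + 1)) ≤ ENNReal.ofReal (Real.exp (c + r K)) • (classMeasA₁₃ θ 0 g₀ K x - shellMeasA₁₃ θ 0 g₀ (ρA F θ hP g₀ os) K x).map ((T4RunLadder.unitFactorisation (datumOfRecord₁₃CoPH F 2 θ hP) (isPrintedAveraged_datumOfRecord₁₃CoPH F 2 θ hP).avgMeasurable g₀).A (0 + K))) :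
    Summit.QuantumFields.YangMills.Theses.BalabanUVNodes.SpineGivenEndpointR13SepCoPH :=
  spineGivenEndpointR13SepCoPH_of_stubTexts h₁
    (stubExpansion13HText_shellSplitOfRecord_of_liveLine_of_keyedShellWeight_of_keyedShellFreeClassSandwich ρA ρB hlive hN21 hU3)

end StubText

end YMDAG.N14.AtSpineReading13CoPH.V.ClassLawRoads.K3V5Shell

end
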